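import Summits.QuantumFields.YangMills.Theorems.FluctuationComparisonRegPrIntLS2BetaCouplingCost
import Summits.QuantumFields.YangMills.Theorems.FluctuationComparisonRegPrIntLS2BetaHybridFourSlot
import HarnessLib

/-!
# S2β · `hFlat` road, brick (G14) of UV3-NODE §64.2 step (2) — THE CHAIN COUPLING COST OF A FOUR-SLOT WORD: ✓G5 §3 (telescoping along
# `σ₁, σ₂, σ₃`) with ✓G6 plugged into each of the three two-slot errors, in the NESTED-mean shape that ✓G10 «HYBRID ×4» outputs

Cell `ym3-torus` (rung R3 = continuum `SU(2)` Yang–Mills on the three-torus — NOT d = 4, NOT infinite volume, NOT a mass gap, NOT Clay).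
Width seat «width 8» `ym3-torus-px8` (gen 21), FREE px helper on crux `stmt-QuantumFields-20520`, count-neutral, DEFINITION-FREE.

WHAT.  For member logarithms `a, b, c, d : ι → 𝔸` (`‖·‖ ≤ ρ ≤ 1∕100`), a context `‖H − 1‖ ≤ e^ρ − 1`, bijections `σ₁, σ₂, σ₃` of `ι` and ANY centres `c₁, c₂, c₃`:
`‖n⁻¹Σ_i log(e^{a_i}e^{b_{σ₁i}}e^{c_{σ₂σ₁i}}e^{d_{σ₃σ₂σ₁i}}H) − n⁻¹Σ_i n⁻¹Σ_j n⁻¹Σ_k n⁻¹Σ_l log(e^{a_i}e^{b_j}e^{c_k}e^{d_l}H)‖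
   ≤ 512·s_b·mean_i‖e^{a_i} − c₁‖ + 512·s_c·mean_i‖e^{a_{σ₁⁻¹i}}e^{b_i} − c₂‖ + 512·s_d·mean_i‖e^{a_{σ₁⁻¹σ₂⁻¹i}}e^{b_{σ₂⁻¹i}}e^{c_i} − c₃‖`
with `s_x` any bound on the pairwise DIFFERENCES of slot `x`'s logarithms — every term (fluctuation of the next slot) × (mean fluctuation of the context prefix).
* §1 `nested_mean4_eq` (nested uniform means = `(n⁴)⁻¹ΣΣΣΣ`), `mean_prod_eq` (`(n²)⁻¹Σ_kΣ_l = |ι×ι|⁻¹Σ_{(k,l)}`), `mean_unit_eq`.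
* §2 ★★★ `norm_chain4_sub_nestedMean4_le`.

HONEST SCOPE.  Instantiation bookkeeping over ✓p814777 (G5), ✓p815864 (G6), ✓p816535 (G10); nothing of Bałaban's analysis; the slot bijections on `Idx P`, the ribbon counts,
the KEY LEMMA, `hFlat`, TUBE-REG∘, GAP♯∘, S2β, crux 20520 and `YM3TorusSU2` are NOT proved; no registered stub is closed; the Yang–Mills mass gap is NOT proved.
References: T. Bałaban, CMP **109** (1987) [Balaban1987RG1] ((0.4)–(0.8) p.253); W. Rossmann, *Lie Groups* (OUP 2002) §1.3 [Rossmann2002].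
-/

set_option autoImplicit false

noncomputable section

open NormedSpace Finset
open scoped BigOperators

namespace Summit.QuantumFields.YangMills.Theorems.FluctuationComparisonRegPrIntLS2BetaChainCouplingCost

open Literature.MathematicalPhysics.QuantumFieldTheory.Balaban1983to89.MatrixLog (mlog)
open Summit.QuantumFields.YangMills.Theorems.FluctuationComparisonRegPrIntLS2BetaCouplingIdentity (norm_mean_chain4_sub_mean_indep_le)
open Summit.QuantumFields.YangMills.Theorems.FluctuationComparisonRegPrIntLS2BetaCouplingCost (norm_coupled_sub_indep_wordMean_le)
open Summit.QuantumFields.YangMills.Theorems.FluctuationComparisonRegPrIntLS2BetaHybridFourSlot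
  (norm_prod_sub_one_le₂ norm_prod_sub_one_le₃ exp_one_div_25_sub_one_le norm_mean_le)
open Literature.Analysis.Calculus.ExpDifferential (norm_exp_sub_one_le_exp_norm_sub_one)

variable {𝔸 : Type*} [NormedRing 𝔸] [NormedAlgebra ℂ 𝔸] [CompleteSpace 𝔸] [NormOneClass 𝔸]
variable {ι : Type*} [Fintype ι] [Nonempty ι]

/-! ## §1 Mean bookkeeping -/

omit [CompleteSpace 𝔸] [NormOneClass 𝔸] [Nonempty ι] in
/-- Nested uniform means over four indices = the `(n⁴)⁻¹`-weighted quadruple sum. [folklore] -/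
theorem nested_mean4_eq (X : ι → ι → ι → ι → 𝔸) :
    ((Fintype.card ι : ℝ))⁻¹ • ∑ i, ((Fintype.card ι : ℝ))⁻¹ • ∑ j, ((Fintype.card ι : ℝ))⁻¹ • ∑ k, ((Fintype.card ι : ℝ))⁻¹ • ∑ l, X i j k l =
      ((Fintype.card ι : ℝ) ^ 4)⁻¹ • ∑ i, ∑ j, ∑ k, ∑ l, X i j k l := by
  simp only [← Finset.smul_sum, smul_smul]
  congr 1
  ring

omit [CompleteSpace 𝔸] [NormOneClass 𝔸] [Nonempty ι] in
/-- `(n²)⁻¹ Σ_k Σ_l X k l = |ι × ι|⁻¹ Σ_{p : ι × ι} X p.1 p.2`. [folklore] -/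
theorem mean_prod_eq (X : ι → ι → 𝔸) :
    ((Fintype.card ι : ℝ) ^ 2)⁻¹ • ∑ k, ∑ l, X k l = ((Fintype.card (ι × ι) : ℝ))⁻¹ • ∑ p : ι × ι, X p.1 p.2 := by
  rw [Fintype.card_prod, Nat.cast_mul, sq, Fintype.sum_prod_type]

omit [CompleteSpace 𝔸] [NormOneClass 𝔸] in
/-- The mean over the one-point type is the value. [folklore] -/
theorem mean_unit_eq (x : 𝔸) : ((Fintype.card Unit : ℝ))⁻¹ • ∑ _u : Unit, x = x := by
  simp

/-! ## §2 The chain coupling cost -/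

/-- ★★★ **CHAIN COUPLING COST OF A FOUR-SLOT WORD** (✓G5 §3 + ✓G6 ×3, in ✓G10's nested-mean shape): member logarithms `‖a i‖, ‖b i‖, ‖c i‖, ‖d i‖ ≤ ρ ≤ 1∕100`,
context `‖H − 1‖ ≤ e^ρ − 1`, bijections `σ₁ σ₂ σ₃`, pairwise-difference bounds `s_b, s_c, s_d` for the slots `b, c, d`, ANY centres `c₁ c₂ c₃`:
the coupled chain mean minus the independent nested mean of `log(e^{a}e^{b}e^{c}e^{d}H)` is at most
`512·s_b·mean_i‖e^{a_i} − c₁‖ + 512·s_c·mean_i‖e^{a_{σ₁⁻¹ i}}e^{b_i} − c₂‖ + 512·s_d·mean_i‖e^{a_{σ₁⁻¹σ₂⁻¹ i}}e^{b_{σ₂⁻¹ i}}e^{c_i} − c₃‖`. [cite: Balaban1987RG1, (0.4)-(0.8) p.253] -/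
theorem norm_chain4_sub_nestedMean4_le (a b c d : ι → 𝔸) (H : 𝔸) {ρ : ℝ} (hρ : ρ ≤ 1 / 100)
    (ha : ∀ i, ‖a i‖ ≤ ρ) (hb : ∀ i, ‖b i‖ ≤ ρ) (hc : ∀ i, ‖c i‖ ≤ ρ) (hd : ∀ i, ‖d i‖ ≤ ρ) (hH : ‖H - 1‖ ≤ Real.exp ρ - 1)
    (σ₁ σ₂ σ₃ : Equiv.Perm ι) (c₁ c₂ c₃ : 𝔸) {sb sc sd : ℝ}
    (hsb : ∀ j j', ‖b j - b j'‖ ≤ sb) (hsc : ∀ j j', ‖c j - c j'‖ ≤ sc) (hsd : ∀ j j', ‖d j - d j'‖ ≤ sd) :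
    ‖((Fintype.card ι : ℝ))⁻¹ • ∑ i, mlog (exp (a i) * exp (b (σ₁ i)) * exp (c (σ₂ (σ₁ i))) * exp (d (σ₃ (σ₂ (σ₁ i)))) * H) -
        ((Fintype.card ι : ℝ))⁻¹ • ∑ i, ((Fintype.card ι : ℝ))⁻¹ • ∑ j, ((Fintype.card ι : ℝ))⁻¹ • ∑ k, ((Fintype.card ι : ℝ))⁻¹ • ∑ l,
          mlog (exp (a i) * exp (b j) * exp (c k) * exp (d l) * H)‖ ≤
      2 * 256 * sd * (((Fintype.card ι : ℝ))⁻¹ * ∑ i, ‖exp (a (σ₁.symm (σ₂.symm i))) * exp (b (σ₂.symm i)) * exp (c i) - c₃‖) +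
      2 * 256 * sc * (((Fintype.card ι : ℝ))⁻¹ * ∑ i, ‖exp (a (σ₁.symm i)) * exp (b i) - c₂‖) +
      2 * 256 * sb * (((Fintype.card ι : ℝ))⁻¹ * ∑ i, ‖exp (a i) - c₁‖) := by
  -- numerics: every partial product stays in the 1/20-ball
  have hρ0 : 0 ≤ ρ := (norm_nonneg _).trans (ha (Classical.arbitrary ι))
  have h4ρ : Real.exp (4 * ρ) - 1 ≤ 1 / 20 := le_trans (by gcongr; linarith) exp_one_div_25_sub_one_le
  have hmono : ∀ {k : ℝ}, k ≤ 4 → 0 ≤ k → Real.exp (k * ρ) - 1 ≤ Real.exp (4 * ρ) - 1 := fun {k} hk hk0 => by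
    have hkρ : k * ρ ≤ 4 * ρ := by nlinarith
    gcongr
  have h1ρ : Real.exp ρ - 1 ≤ Real.exp (4 * ρ) - 1 := by simpa using hmono (k := 1) (by norm_num) (by norm_num)
  have hρ20 : ρ ≤ 1 / 20 := by linarith
  have hexp1 : ∀ {x : 𝔸}, ‖x‖ ≤ ρ → ‖exp x - 1‖ ≤ Real.exp ρ - 1 := fun {x} hx =>
    (norm_exp_sub_one_le_exp_norm_sub_one x).trans (by gcongr)
  have hea : ∀ i, ‖exp (a i) - 1‖ ≤ Real.exp ρ - 1 := fun i => hexp1 (ha i)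
  have heb : ∀ i, ‖exp (b i) - 1‖ ≤ Real.exp ρ - 1 := fun i => hexp1 (hb i)
  have hec : ∀ i, ‖exp (c i) - 1‖ ≤ Real.exp ρ - 1 := fun i => hexp1 (hc i)
  have hed : ∀ i, ‖exp (d i) - 1‖ ≤ Real.exp ρ - 1 := fun i => hexp1 (hd i)
  -- the word and the three two-slot functionals (G6's shapes)
  set Ψ : ι → ι → ι → ι → 𝔸 := fun i j k l => mlog (exp (a i) * exp (b j) * exp (c k) * exp (d l) * H) with hΨ
  set Φ₁ : ι → ι → 𝔸 := fun i j => ((Fintype.card (ι × ι) : ℝ))⁻¹ • ∑ p : ι × ι, mlog (exp (a i) * exp (b j) * (exp (c p.1) * exp (d p.2) * H))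
    with hΦ₁
  set Φ₂ : ι → ι → 𝔸 := fun i j => ((Fintype.card ι : ℝ))⁻¹ • ∑ l, mlog (exp (a (σ₁.symm i)) * exp (b i) * exp (c j) * (exp (d l) * H)) with hΦ₂
  set Φ₃ : ι → ι → 𝔸 := fun i j => ((Fintype.card Unit : ℝ))⁻¹ • ∑ _u : Unit,
    mlog (exp (a (σ₁.symm (σ₂.symm i))) * exp (b (σ₂.symm i)) * exp (c i) * exp (d j) * H) with hΦ₃
  -- G5 §3's hypotheses h₁ h₂ h₃
  have h₁ : ∀ i j, Φ₁ i j = ((Fintype.card ι : ℝ) ^ 2)⁻¹ • ∑ k, ∑ l, Ψ i j k l := fun i j => by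
    simp only [hΦ₁, hΨ, mul_assoc]
    rw [mean_prod_eq]
  have h₂ : ∀ i j, Φ₂ i j = ((Fintype.card ι : ℝ))⁻¹ • ∑ l, Ψ (σ₁.symm i) i j l := fun i j => by
    simp only [hΦ₂, hΨ, mul_assoc]
  have h₃ : ∀ i j, Φ₃ i j = Ψ (σ₁.symm (σ₂.symm i)) (σ₂.symm i) i j := fun i j => by
    simp only [hΦ₃, hΨ, mean_unit_eq]
  -- the three two-slot errors by G6
  have e₁ : ‖((Fintype.card ι : ℝ))⁻¹ • ∑ i, Φ₁ i (σ₁ i) - ((Fintype.card ι : ℝ) ^ 2)⁻¹ • ∑ i, ∑ j, Φ₁ i j‖ ≤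
      2 * 256 * sb * (((Fintype.card ι : ℝ))⁻¹ * ∑ i, ‖exp (a i) - c₁‖) := by
    refine norm_coupled_sub_indep_wordMean_le (κ := ι × ι) (fun i => exp (a i)) b (fun p : ι × ι => exp (c p.1) * exp (d p.2) * H) Φ₁
      (fun i j => by simp only [hΦ₁]) (fun i => (hea i).trans (h1ρ.trans h4ρ)) (fun j => (hb j).trans hρ20)
      (fun p => ((norm_prod_sub_one_le₃ (hec p.1) (hed p.2) hH).trans (hmono (by norm_num) (by norm_num))).trans h4ρ) σ₁ c₁ hsb
  have e₂ : ‖((Fintype.card ι : ℝ))⁻¹ • ∑ i, Φ₂ i (σ₂ i) - ((Fintype.card ι : ℝ) ^ 2)⁻¹ • ∑ i, ∑ j, Φ₂ i j‖ ≤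
      2 * 256 * sc * (((Fintype.card ι : ℝ))⁻¹ * ∑ i, ‖exp (a (σ₁.symm i)) * exp (b i) - c₂‖) := by
    refine norm_coupled_sub_indep_wordMean_le (κ := ι) (fun i => exp (a (σ₁.symm i)) * exp (b i)) c (fun l => exp (d l) * H) Φ₂
      (fun i j => by simp only [hΦ₂]) (fun i => ((norm_prod_sub_one_le₂ (hea _) (heb i)).trans (hmono (by norm_num) (by norm_num))).trans h4ρ)
      (fun j => (hc j).trans hρ20)
      (fun l => ((norm_prod_sub_one_le₂ (hed l) hH).trans (hmono (by norm_num) (by norm_num))).trans h4ρ) σ₂ c₂ hsc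
  have e₃ : ‖((Fintype.card ι : ℝ))⁻¹ • ∑ i, Φ₃ i (σ₃ i) - ((Fintype.card ι : ℝ) ^ 2)⁻¹ • ∑ i, ∑ j, Φ₃ i j‖ ≤
      2 * 256 * sd * (((Fintype.card ι : ℝ))⁻¹ * ∑ i, ‖exp (a (σ₁.symm (σ₂.symm i))) * exp (b (σ₂.symm i)) * exp (c i) - c₃‖) := by
    refine norm_coupled_sub_indep_wordMean_le (κ := Unit) (fun i => exp (a (σ₁.symm (σ₂.symm i))) * exp (b (σ₂.symm i)) * exp (c i)) d
      (fun _ : Unit => H) Φ₃ (fun i j => by simp only [hΦ₃])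
      (fun i => ((norm_prod_sub_one_le₃ (hea _) (heb _) (hec i)).trans (hmono (by norm_num) (by norm_num))).trans h4ρ)
      (fun j => (hd j).trans hρ20) (fun _ => hH.trans (h1ρ.trans h4ρ)) σ₃ c₃ hsd
  -- G5 §3 + the nested-mean bookkeeping
  have hmain := norm_mean_chain4_sub_mean_indep_le Ψ σ₁ σ₂ σ₃ Φ₁ Φ₂ Φ₃ h₁ h₂ h₃ e₁ e₂ e₃
  rw [nested_mean4_eq]
  simpa only [hΨ] using hmain

end Summit.QuantumFields.YangMills.Theorems.FluctuationComparisonRegPrIntLS2BetaChainCouplingCost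

end
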